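import Summits.AtomisticToContinuum.Crystallization.Theorems.HullExactificationCascadeRobustBarlowTemplateTransportDefs
import Summits.AtomisticToContinuum.Crystallization.Theorems.HullExactificationCascadeRobustBarlowTemplateDevelopCharts
import Summits.AtomisticToContinuum.Crystallization.Theorems.HullExactificationCascadeRobustBarlowTemplateStubReciprocity
import Summits.AtomisticToContinuum.Crystallization.Theorems.PalmUnimodularRigidityShellsToBarlowChartCharts

/-!
# `develop_zchart` for line `registered` (crux `RobustBarlowTemplate`, stmt-AtomisticToContinuum-12088)

## Statement
`develop_zchart`: for a `δ`-separated configuration `S ⊆ ℝ³` all of whose points are `1/20`-good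
and whose shell relation is reciprocal with comparable scales (`Recip S`), every point `x ∈ S`
carries a scale-relative INTEGER chart `IsZChart S x P A nbr`: the shell of `x` is labelled
bijectively by `P ∈ {fcc3Int, hcpInt}`, each label `t` lands within `nnd S x / 20` of
`x + (nnd S x/√18) · A t`, and shell-adjacency among shell points = label pairs at squared
distance `18`.

## Proof outline
This is the landed real chart `develop_charts` at `x` re-expressed over integer labels (the same
conversion as `isZChart_of_localChart` of the sibling crux 9227): the real pattern is
`scaledPattern P 18` (`fccKissingPattern_eq_scaledPattern_fcc3Int`,
`hcpKissingPattern_eq_scaledPattern_hcpInt`), so with `nbr t := e (t/√18)` the bijection is the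
composite of `e` with the bijection `t ↦ t/√18` of `P` onto `scaledPattern P 18`
(`scale18_injective`), the estimate is `x + nnd • A (t/√18) = x + (nnd/√18) • A t`
(`map_smul`, `smul_smul`), and the links are read through `dist_scale18_eq_one_iff`.

## Contents
* `develop_zchart` — the registered sub-goal.
-/

noncomputable section

namespace Summit.AtomisticToContinuum.Crystallization.Theorems.HullExactificationCascadeRobustBarlowTemplate

open Literature.MathematicalPhysics.StatisticalMechanics Literature.Geometry.DiscreteGeometry
open Summit.AtomisticToContinuum.Crystallization.Theorems.PalmUnimodularRigidityShellsToBarlowChart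
  (contacts fcc3Int fccKissingPattern_eq_scaledPattern_fcc3Int hcpKissingPattern_eq_scaledPattern_hcpInt
    scale18_injective dist_scale18_eq_one_iff)
open RealInnerProductSpace

/-- Euclidean `3`-space. -/
local notation "E3" => EuclideanSpace ℝ (Fin 3)

/-- SUB-GOAL `develop_zchart` (registered on stmt-12088; toward `develop_transport`): every point
of an everywhere-good configuration with reciprocal shells carries a scale-relative integer chart. -/
theorem develop_zchart :
    ∀ δ : ℝ, 0 < δ → ∀ S : Set E3, Sep δ S → (∀ y ∈ S, Good S y) → Recip S → ∀ x ∈ S,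
      ∃ P : Finset (Fin 3 → ℤ), ∃ A : E3 →ₗᵢ[ℝ] E3, ∃ nbr : (Fin 3 → ℤ) → E3, IsZChart S x P A nbr := by
  intro δ hδ S hS hG hR x hx
  obtain ⟨Pr, hPr, A, e, hbij, hclose, hlink⟩ := develop_charts δ hδ S hS hG hR x hx
  -- the integer pattern behind `Pr`
  obtain ⟨P, hP, hPrP⟩ : ∃ P : Finset (Fin 3 → ℤ), (P = fcc3Int ∨ P = hcpInt) ∧
      Pr = scaledPattern P 18 := by
    rcases hPr with rfl | rfl
    · exact ⟨fcc3Int, Or.inl rfl, fccKissingPattern_eq_scaledPattern_fcc3Int⟩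
    · exact ⟨hcpInt, Or.inr rfl, hcpKissingPattern_eq_scaledPattern_hcpInt⟩
  have hPr_coe : (↑Pr : Set E3) =
      (fun t : Fin 3 → ℤ => ((Real.sqrt 18)⁻¹ • intVec t : E3)) '' ↑P := by
    rw [hPrP, scaledPattern, Finset.coe_image]; rfl
  have hsc_mem : ∀ t ∈ P, ((Real.sqrt 18)⁻¹ • intVec t : E3) ∈ Pr := fun t ht => by
    rw [hPrP, scaledPattern]; exact Finset.mem_image_of_mem _ ht
  refine ⟨P, A, fun t => e ((Real.sqrt 18)⁻¹ • intVec t), hP, ?_, ?_, ?_⟩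
  · -- bijection
    have hsc_bij : Set.BijOn (fun t : Fin 3 → ℤ => ((Real.sqrt 18)⁻¹ • intVec t : E3)) ↑P ↑Pr := by
      rw [hPr_coe]; exact scale18_injective.injOn.bijOn_image
    exact hbij.comp hsc_bij
  · -- closeness
    intro t ht
    have h1 := hclose _ (hsc_mem t ht)
    rw [LinearIsometry.map_smul, smul_smul] at h1
    exact h1
  · -- links
    intro t ht t' ht'
    have h1 := hlink _ (hsc_mem t ht) _ (hsc_mem t' ht')
    rw [dist_scale18_eq_one_iff] at h1
    exact ⟨fun hb => h1.2 hb, fun hs => h1.1 hs⟩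

end Summit.AtomisticToContinuum.Crystallization.Theorems.HullExactificationCascadeRobustBarlowTemplate

end
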